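import Summits.Ventures.DiscreteObjects.PP12.FanoFiveKernelSearch

/-!
# PP(12), order 5: SOUNDNESS of the fast kernel search `Kernel.search` (kernel)
Framing: lottery ticket; floor = certified bounds/negative ranges.

Cell pub-namedobj (venture DiscreteObjects), target (M), designs gen 18; continues `FanoFiveKernelSearch`. **`Kernel.search_sound`**: if
`Kernel.search f ws cands k = true` then no sublist `C` of `cands` of length `k` makes `ws ++ C` pass the leaf test `Cert.FullP`. Ingredients:
`FullP` is invariant under permutations of the list (`fullP_perm`, all its clauses are counts); a word of a `FullP` completion passes `Cert.okAdd` at the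
node (`Cert.not_fullP_of_okAdd_false` of `FanoFiveWordChecker`), so completions are sublists of the viable candidates (`sublist_via`); the forward check
is sound by splitting the exact counts of `FullP` over `ws ++ C` (`not_fullP_of_short`); the binary branching is sound because a completion either
contains the branching candidate `c` (then it is, up to permutation, a completion of `ws ++ [c]` from `via.erase c`) or is a completion from `via.erase c`
(`branch_sound`). The branching heuristics (`classes/pick`) carry no proof obligation. Nothing is evaluated here; no census statement is discharged.
No `sorry`, no new axioms.
-/

namespace Summit.Ventures.DiscreteObjects.PP12

namespace FanoFive

namespace Kernel

open Cert

/-! ### the leaf test is a property of the underlying multiset -/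

/-- `FullP` is invariant under permutations of the list -/
theorem fullP_perm {L L' : List ℕ} (h : L.Perm L') (hF : FullP L) : FullP L' := by
  obtain ⟨hcol, hprof, hcorr⟩ := hF
  have ccol : ∀ x : Fin 7, colc L' x = colc L x := fun x => by unfold colc; exact (h.countP_eq _).symm
  have ccnt : ∀ u d : ℕ, cntd L' u d = cntd L u d := fun u d => by unfold cntd; exact (h.countP_eq _).symm
  have cpair : ∀ x y : Fin 7, colpair L' x y = colpair L x y := fun x y => by unfold colpair; exact (h.countP_eq _).symm
  refine ⟨fun x => by rw [ccol]; exact hcol x, fun u hu => ?_, fun x y hxy => by rw [cpair]; exact hcorr x y hxy⟩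
  rw [ccnt, ccnt, ccnt]
  exact hprof u (h.symm.subset hu)

/-! ### soundness of the forward check -/

/-- the size of a distance class is a count -/
theorem length_clsD (via : List ℕ) (u d : ℕ) : (clsD via u d).length = cntd via u d := by
  unfold clsD cntd; rw [List.countP_eq_length_filter]

/-- the size of a column class is a count -/
theorem length_clsC (via : List ℕ) (x : Fin 7) : (clsC via x).length = colc via x := by
  unfold clsC colc; rw [List.countP_eq_length_filter]

/-- distance counts split over an append -/
theorem cntd_append (ws C : List ℕ) (u d : ℕ) : cntd (ws ++ C) u d = cntd ws u d + cntd C u d := by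
  unfold cntd; rw [List.countP_append]

/-- **the forward check is sound**: if some constraint of the node has fewer viable candidates than it needs, no completion from `via` passes `FullP` -/
theorem not_fullP_of_short {ws via C : List ℕ} (hC : C.Sublist via) (h : short (classes (ents ws) ws via) = true) : ¬ FullP (ws ++ C) := by
  intro hF
  unfold short at h
  rw [List.any_eq_true] at h
  obtain ⟨p, hp, hlt⟩ := h
  simp only [decide_eq_true_eq] at hlt
  unfold classes at hp
  rw [List.mem_append] at hp
  rcases hp with hp | hp
  · rw [List.mem_flatMap] at hp
    obtain ⟨e, he, hp⟩ := hp
    unfold ents at he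
    rw [List.mem_map] at he
    obtain ⟨u, hu, rfl⟩ := he
    have huL : u ∈ ws ++ C := List.mem_append_left C hu
    obtain ⟨h2, h4, h6⟩ := hF.2.1 u huL
    rw [cntd_append] at h2 h4 h6
    have m2 : cntd C u 2 ≤ cntd via u 2 := countP_le_of_sublist hC _
    have m4 : cntd C u 4 ≤ cntd via u 4 := countP_le_of_sublist hC _
    have m6 : cntd C u 6 ≤ cntd via u 6 := countP_le_of_sublist hC _
    simp only [List.mem_cons, List.mem_nil_iff, or_false] at hp
    rcases hp with rfl | rfl | rfl
    · simp only [length_clsD] at hlt; omega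
    · simp only [length_clsD] at hlt; omega
    · simp only [length_clsD] at hlt; omega
  · rw [List.mem_map] at hp
    obtain ⟨x, -, rfl⟩ := hp
    simp only [length_clsC] at hlt
    have e := hF.1 x
    rw [colc_append] at e
    have m : colc C x ≤ colc via x := countP_le_of_sublist hC _
    omega

/-! ### viability -/

/-- in a `FullP` completion every added word passes `okAdd` at the node -/
theorem okAdd_of_fullP {ws C : List ℕ} (hF : FullP (ws ++ C)) {c : ℕ} (hc : c ∈ C) : okAdd (ents ws) ws c = true := by
  by_contra h
  rw [Bool.not_eq_true] at h
  have hsub : (ws ++ [c]).Sublist (ws ++ C) := (List.singleton_sublist.2 hc).append_left ws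
  exact not_fullP_of_okAdd_false hsub h hF

/-- hence a `FullP` completion from `cands` is a completion from the viable candidates -/
theorem sublist_via {ws cands C : List ℕ} (hC : C.Sublist cands) (hF : FullP (ws ++ C)) :
    C.Sublist (cands.filter fun c => okAdd (ents ws) ws c) := by
  have e : C.filter (fun c => okAdd (ents ws) ws c) = C := List.filter_eq_self.2 fun c hc => okAdd_of_fullP hF hc
  rw [← e]
  exact hC.filter _

/-! ### the three layers of a node -/

/-- soundness of the branching layer, given the soundness of the recursive calls and of the forward check -/
theorem branch_sound {rec : List ℕ → List ℕ → ℕ → Bool}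
    (hrec : ∀ (ws cands : List ℕ) (k : ℕ), rec ws cands k = true → ∀ C : List ℕ, C.Sublist cands → C.length = k → ¬ FullP (ws ++ C))
    {ws via : List ℕ} {k : ℕ} {cl : List (ℕ × List ℕ)}
    (hshort : short cl = true → ∀ C : List ℕ, C.Sublist via → C.length = k + 1 → ¬ FullP (ws ++ C))
    (h : branch rec ws via k cl = true) : ∀ C : List ℕ, C.Sublist via → C.length = k + 1 → ¬ FullP (ws ++ C) := by
  intro C hC hlen hF
  unfold branch at h
  by_cases hs : short cl = true
  · exact hshort hs C hC hlen hF
  · rw [if_neg hs] at h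
    split at h
    · exact absurd h Bool.false_ne_true
    · next c _ _ =>
      by_cases hcv : c ∈ via
      · rw [if_pos hcv, Bool.and_eq_true] at h
        obtain ⟨hin, hout⟩ := h
        by_cases hcC : c ∈ C
        · have hperm : (ws ++ C).Perm ((ws ++ [c]) ++ C.erase c) := by
            rw [List.append_assoc, List.singleton_append]
            exact (List.perm_cons_erase hcC).append_left ws
          have hlen' : (C.erase c).length = k := by rw [List.length_erase_of_mem hcC, hlen]; rfl
          exact hrec _ _ _ hin (C.erase c) (hC.erase c) hlen' (fullP_perm hperm hF)
        · have e : C.erase c = C := List.erase_of_not_mem hcC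
          have hC' : (C.erase c).Sublist (via.erase c) := hC.erase c
          rw [e] at hC'
          exact hrec _ _ _ hout C hC' hlen hF
      · rw [if_neg hcv] at h
        exact absurd h Bool.false_ne_true

/-- soundness of a node given its viable candidates -/
theorem step_sound {rec : List ℕ → List ℕ → ℕ → Bool}
    (hrec : ∀ (ws cands : List ℕ) (k : ℕ), rec ws cands k = true → ∀ C : List ℕ, C.Sublist cands → C.length = k → ¬ FullP (ws ++ C))
    {ws via : List ℕ} {k : ℕ} (h : step rec (ents ws) ws via k = true) :
    ∀ C : List ℕ, C.Sublist via → C.length = k + 1 → ¬ FullP (ws ++ C) := by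
  unfold step at h
  by_cases hl : via.length < k + 1
  · intro C hC hlen _
    have := hC.length_le
    omega
  · rw [if_neg hl] at h
    exact branch_sound hrec (fun hs C hC _ => not_fullP_of_short hC hs) h

/-- soundness of a node -/
theorem node_sound {rec : List ℕ → List ℕ → ℕ → Bool}
    (hrec : ∀ (ws cands : List ℕ) (k : ℕ), rec ws cands k = true → ∀ C : List ℕ, C.Sublist cands → C.length = k → ¬ FullP (ws ++ C))
    {ws cands : List ℕ} {k : ℕ} (h : node rec ws cands k (ents ws) = true) :
    ∀ C : List ℕ, C.Sublist cands → C.length = k + 1 → ¬ FullP (ws ++ C) := by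
  intro C hC hlen hF
  exact step_sound hrec h C (sublist_via hC hF) hlen hF

/-- **SOUNDNESS OF THE SEARCH**: `search f ws cands k = true` refutes every completion of `ws` by `k` words taken as a sublist of `cands` -/
theorem search_sound : ∀ (f : ℕ) (ws cands : List ℕ) (k : ℕ), search f ws cands k = true →
    ∀ C : List ℕ, C.Sublist cands → C.length = k → ¬ FullP (ws ++ C)
  | 0, ws, cands, k, h, _, _, _ => by simp [search] at h
  | f + 1, ws, cands, 0, h, C, _, hlen => by
    have hC : C = [] := List.length_eq_zero_iff.1 hlen
    subst hC
    simp only [search, Bool.not_eq_true', decide_eq_false_iff_not] at h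
    simpa using h
  | f + 1, ws, cands, k + 1, h, C, hC, hlen => by
    rw [search] at h
    exact node_sound (search_sound f) h C hC hlen

/-- the form used by the certificate: from a refuted start list no nine weight-4 words complete it to a list passing `FullP` -/
theorem search_refutes {ws : List ℕ} (h : search 45 ws W4 9 = true) : ∀ C : List ℕ, C.Sublist W4 → C.length = 9 → ¬ FullP (ws ++ C) :=
  search_sound 45 ws W4 9 h

end Kernel

end FanoFive

end Summit.Ventures.DiscreteObjects.PP12
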